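import Summits.AnomalousDissipation.AnomalousDissipation.Theorems.SoloBlindSmallDivisorRung
import Mathlib.Analysis.Normed.Group.Tannery

/-!
# The small-divisor rung lies strictly below the zeroth law: its dissipation vanishes

`SoloBlindSmallDivisorRung` exhibits a FIXED smooth force on `T³` whose laminar states along any
vanishing viscosity sequence have bounded mean energy and mean enstrophy
`meanDissipation / ν → ∞`.  Here we add the matching CEILING: for a lacunary shear design the
enstrophy of the laminar state is at most twice the modewise sum
`4π² ∑ₙ |Kₙ|² aₙ² / |σ_ν(Kₙ)|²` (the two copies `±Kₙ` of each mode), and for the Liouville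
design each mode obeys the AM–GM bound `ν · 4π²|Kₙ|² aₙ² / |σ_ν(Kₙ)|² ≤ aₙ²/(4π dₙ) = π dₙ 4⁻ⁿ`
uniformly in `ν`, while tending to `0` with `ν` for fixed `n`.  Tannery's theorem then gives
`meanDissipation → 0` along the family.  The headline theorem
`SmallDivisor.exists_force_rungOne` packages the three facts: ONE fixed smooth force, and along
EVERY sequence `νⱼ → 0⁺` global Leray–Hopf solutions with bounded energy, enstrophy `→ ∞` and
dissipation `→ 0` — the first rung of the rate ladder below `Literature.Turb.ZerothLaw`, inhabited
without turbulence (loss of differentiability in a cohomological equation).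

All statements are elementary consequences of Parseval and the explicit coefficients. [folklore]
-/

open MeasureTheory Filter Topology Set UnitAddTorus Function
open scoped ENNReal NNReal

noncomputable section

namespace Summit.AnomalousDissipation.AnomalousDissipation.Theorems

open Literature.Analysis.FunctionSpaces Literature.Analysis.FunctionSpaces.Torus
open Literature.Analysis.FunctionSpaces.EuclideanSpace
open Literature.Analysis.FluidPDE

/-- The physical flat unit torus `T³` (local notation). -/
local notation "𝕋³" => UnitAddTorus (Fin 3)
/-- Velocity values on `T³` (local notation). -/
local notation "E³" => EuclideanSpace ℝ (Fin 3)
/-- Complex coefficient vectors (local notation). -/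
local notation "ℂ³" => EuclideanSpace ℂ (Fin 3)

namespace ShearDesign

variable (D : ShearDesign)

/-- `φ(k)² = ext(k)² + ext(-k)²`: at most one of the two one-sided extensions is nonzero. -/
theorem amp_sq (k : Fin 3 → ℤ) : D.amp k ^ 2 = D.ext k ^ 2 + D.ext (-k) ^ 2 := by
  rcases D.trichotomy k with ⟨n, rfl⟩ | ⟨n, rfl⟩ | ⟨h₁, h₂⟩
  · rw [amp_K, ext_K, ext_negK]; ring
  · rw [amp_negK, neg_neg, ext_negK, ext_K]; ring
  · rw [amp, h₁, h₂]; ring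

/-- `|σ_ν(-k)|² = |σ_ν(k)|²`. -/
theorem norm_sq_shearSymbol_neg (ν : ℝ) (M : E³) (k : Fin 3 → ℤ) :
    ‖shearSymbol ν M (-k)‖ ^ 2 = ‖shearSymbol ν M k‖ ^ 2 := by
  rw [norm_sq_shearSymbol, norm_sq_shearSymbol, freqNormSq_neg, kdot_neg_left, mul_neg, neg_sq]

/-- The modewise enstrophy density of a design at viscosity `ν` and momentum `M`:
`|Kₙ|² aₙ² / |σ_ν(Kₙ)|²`. -/
def modeEnstrophy (ν : ℝ) (M : E³) (n : ℕ) : ℝ :=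
  freqNormSq (D.K n) * (D.a n ^ 2 / ‖shearSymbol ν M (D.K n)‖ ^ 2)

/-- Modewise enstrophy weights are nonnegative. -/
theorem modeEnstrophy_nonneg (ν : ℝ) (M : E³) (n : ℕ) : 0 ≤ D.modeEnstrophy ν M n := by
  unfold modeEnstrophy; exact mul_nonneg (freqNormSq_nonneg _) (by positivity)

/-- **Enstrophy of the laminar state from above**: if `𝓕 u = b + δ₀ M` and the modewise
enstrophies are summable then `‖∇u‖₂² ≤ 4π² · 2 ∑ₙ |Kₙ|² aₙ² / |σ_ν(Kₙ)|²`. [folklore] -/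
theorem eGradNormSq_le_of_coeff {ν : ℝ} {M : E³} {u : 𝕋³ → E³}
    (hû : mFourierCoeff (complexify ∘ u) =
      D.stateCoeff ν M + (Pi.single (0 : Fin 3 → ℤ) (complexify M) : (Fin 3 → ℤ) → ℂ³))
    (hB : Summable (D.modeEnstrophy ν M)) :
    eGradNormSq u ≤ ENNReal.ofReal (4 * Real.pi ^ 2) *
      ENNReal.ofReal (2 * ∑' n, D.modeEnstrophy ν M n) := by
  rw [eGradNormSq, eHomSobolevSeminorm, ENNReal.rpow_half_sq]
  gcongr
  -- pointwise majorant on the lattice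
  obtain ⟨r, hr⟩ : ∃ r : (Fin 3 → ℤ) → ℝ, r = fun k =>
    freqNormSq k * (D.amp k ^ 2 / ‖shearSymbol ν M k‖ ^ 2) := ⟨_, rfl⟩
  have hr0 : ∀ k, 0 ≤ r k := fun k => by
    rw [hr]; exact mul_nonneg (freqNormSq_nonneg _) (by positivity)
  have hpt : ∀ k, (if k = 0 then 0 else ENNReal.ofReal (freqNormSq k ^ (1 : ℝ))) *
      ‖mFourierCoeff (complexify ∘ u) k‖ₑ ^ 2 ≤ ENNReal.ofReal (r k) := by
    intro k
    by_cases hk : k = 0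
    · rw [if_pos hk, zero_mul]; exact bot_le
    · have h : (if k = 0 then 0 else ENNReal.ofReal (freqNormSq k ^ (1 : ℝ))) *
          ‖mFourierCoeff (complexify ∘ u) k‖ₑ ^ 2 = ENNReal.ofReal (r k) := by
        rw [if_neg hk, Real.rpow_one, hû, Pi.add_apply, Pi.single_eq_of_ne hk, add_zero,
          ← ofReal_norm, ← ENNReal.ofReal_pow (norm_nonneg _), norm_stateCoeff, div_pow, sq_abs,
          ← ENNReal.ofReal_mul (freqNormSq_nonneg _), hr]
      exact h.le
  -- the two one-sided majorants
  obtain ⟨gp, hgp⟩ : ∃ gp : (Fin 3 → ℤ) → ℝ, gp = fun k =>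
    freqNormSq k * (D.ext k ^ 2 / ‖shearSymbol ν M k‖ ^ 2) := ⟨_, rfl⟩
  obtain ⟨gn, hgn⟩ : ∃ gn : (Fin 3 → ℤ) → ℝ, gn = fun k =>
    freqNormSq k * (D.ext (-k) ^ 2 / ‖shearSymbol ν M k‖ ^ 2) := ⟨_, rfl⟩
  have hsplit : ∀ k, r k = gp k + gn k := fun k => by
    rw [hr, hgp, hgn]; dsimp only; rw [amp_sq, add_div, mul_add]
  have hp_eq : gp = extend D.K (D.modeEnstrophy ν M) 0 := by
    rw [hgp]
    funext k
    by_cases h : ∃ n, D.K n = k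
    · obtain ⟨n, rfl⟩ := h
      rw [D.K_injective.extend_apply, ext_K, modeEnstrophy]
    · rw [extend_apply' _ _ _ h, D.ext_of_not h, Pi.zero_apply]; simp
  have hn_eq : gn = extend D.negK (D.modeEnstrophy ν M) 0 := by
    rw [hgn]
    funext k
    by_cases h : ∃ n, D.negK n = k
    · obtain ⟨n, rfl⟩ := h
      rw [D.negK_injective.extend_apply, negK_apply, neg_neg, ext_K, freqNormSq_neg,
        norm_sq_shearSymbol_neg, modeEnstrophy]
    · have h' : ¬∃ n, D.K n = -k := fun ⟨n, hn⟩ => h ⟨n, by rw [negK_apply, hn, neg_neg]⟩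
      rw [extend_apply' _ _ _ h, D.ext_of_not h', Pi.zero_apply]; simp
  have hsp : Summable gp := by rw [hp_eq, summable_extend_zero D.K_injective]; exact hB
  have hsn : Summable gn := by rw [hn_eq, summable_extend_zero D.negK_injective]; exact hB
  have htp : ∑' k, gp k = ∑' n, D.modeEnstrophy ν M n := by rw [hp_eq, tsum_extend_zero D.K_injective]
  have htn : ∑' k, gn k = ∑' n, D.modeEnstrophy ν M n := by
    rw [hn_eq, tsum_extend_zero D.negK_injective]
  have hgp0 : ∀ k, 0 ≤ gp k := fun k => by
    rw [hgp]; exact mul_nonneg (freqNormSq_nonneg _) (by positivity)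
  have hgn0 : ∀ k, 0 ≤ gn k := fun k => by
    rw [hgn]; exact mul_nonneg (freqNormSq_nonneg _) (by positivity)
  -- assemble over finite sets
  rw [ENNReal.tsum_eq_iSup_sum]
  refine iSup_le fun T => ?_
  calc ∑ k ∈ T, (if k = 0 then 0 else ENNReal.ofReal (freqNormSq k ^ (1 : ℝ))) *
        ‖mFourierCoeff (complexify ∘ u) k‖ₑ ^ 2
      ≤ ∑ k ∈ T, ENNReal.ofReal (r k) := Finset.sum_le_sum fun k _ => hpt k
    _ = ENNReal.ofReal (∑ k ∈ T, r k) := (ENNReal.ofReal_sum_of_nonneg fun k _ => hr0 k).symm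
    _ ≤ ENNReal.ofReal (2 * ∑' n, D.modeEnstrophy ν M n) := by
        refine ENNReal.ofReal_le_ofReal ?_
        calc ∑ k ∈ T, r k = ∑ k ∈ T, gp k + ∑ k ∈ T, gn k := by
              rw [← Finset.sum_add_distrib]; exact Finset.sum_congr rfl fun k _ => hsplit k
          _ ≤ ∑' k, gp k + ∑' k, gn k :=
              add_le_add (hsp.sum_le_tsum T fun k _ => hgp0 k) (hsn.sum_le_tsum T fun k _ => hgn0 k)
          _ = 2 * ∑' n, D.modeEnstrophy ν M n := by rw [htp, htn]; ring

/-- Real form of the enstrophy ceiling. [folklore] -/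
theorem dissipation_le_of_coeff {ν : ℝ} {M : E³} {u : 𝕋³ → E³}
    (hû : mFourierCoeff (complexify ∘ u) =
      D.stateCoeff ν M + (Pi.single (0 : Fin 3 → ℤ) (complexify M) : (Fin 3 → ℤ) → ℂ³))
    (hB : Summable (D.modeEnstrophy ν M)) :
    (eGradNormSq u).toReal ≤ 4 * Real.pi ^ 2 * (2 * ∑' n, D.modeEnstrophy ν M n) := by
  have h0 : 0 ≤ ∑' n, D.modeEnstrophy ν M n := tsum_nonneg (D.modeEnstrophy_nonneg ν M)
  have h := ENNReal.toReal_mono (ENNReal.mul_ne_top ENNReal.ofReal_ne_top ENNReal.ofReal_ne_top)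
    (D.eGradNormSq_le_of_coeff hû hB)
  rwa [ENNReal.toReal_mul, ENNReal.toReal_ofReal (by positivity : (0 : ℝ) ≤ 4 * Real.pi ^ 2),
    ENNReal.toReal_ofReal (mul_nonneg zero_le_two h0)] at h

end ShearDesign

namespace SmallDivisor

open ShearDesign

/-! ### The Liouville design: modewise AM–GM ceiling and Tannery -/

/-- `dₙ ≤ 10` (crude; in fact `dₙ < qₙ^{1-n}`). -/
theorem d_le_ten (n : ℕ) : d n ≤ 10 := by
  have h := d_lt n
  rcases n with _ | k
  · rw [pow_zero, div_one, cast_q, Nat.factorial_zero, pow_one] at h; exact h.le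
  · have hq : (1 : ℝ) ≤ q (k + 1) := one_le_q _
    have h1 : (q (k + 1) : ℝ) / (q (k + 1) : ℝ) ^ (k + 1) ≤ 1 := by
      rw [div_le_one (by positivity), pow_succ]
      exact le_mul_of_one_le_left (by positivity) (one_le_pow₀ hq)
    linarith

/-- **Modewise AM–GM ceiling**, uniform in `ν` (AM–GM `2AB ≤ A² + B²` on `|σ|² = A² + B²`):
`ν · 4π²|Kₙ|² aₙ² / |σ_ν(Kₙ)|² ≤ aₙ²/(4π dₙ) = π dₙ 4⁻ⁿ`. [folklore] -/
theorem mode_dissipation_le (ν : ℝ) (n : ℕ) :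
    ν * (4 * Real.pi ^ 2 * design.modeEnstrophy ν mom n) ≤ Real.pi * d n * (1 / 4 : ℝ) ^ n := by
  have hd := d_pos n
  have hS : 0 < ‖shearSymbol ν mom (K n)‖ ^ 2 := by
    have := sq_kdot_le_norm_sq_shearSymbol ν mom (K n)
    rw [kdot_K_mom] at this
    exact lt_of_lt_of_le (by positivity) this
  have hSeq : ‖shearSymbol ν mom (K n)‖ ^ 2 =
      (ν * (4 * Real.pi ^ 2 * freqNormSq (K n))) ^ 2 + (2 * Real.pi * d n) ^ 2 := by
    rw [norm_sq_shearSymbol, kdot_K_mom]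
  have hF := freqNormSq_nonneg (K n)
  have key : ν * (4 * Real.pi ^ 2 * freqNormSq (K n)) / ‖shearSymbol ν mom (K n)‖ ^ 2 ≤
      1 / (4 * Real.pi * d n) := by
    rw [div_le_div_iff₀ hS (by positivity), one_mul, hSeq]
    nlinarith [two_mul_le_add_sq (ν * (4 * Real.pi ^ 2 * freqNormSq (K n))) (2 * Real.pi * d n)]
  have ha : a n ^ 2 = 4 * Real.pi ^ 2 * d n ^ 2 * (1 / 4 : ℝ) ^ n := by
    have h4 : ((1 / 2 : ℝ) ^ n) ^ 2 = (1 / 4 : ℝ) ^ n := by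
      rw [← pow_mul, mul_comm n 2, pow_mul]; norm_num
    rw [a, ← h4]; ring
  calc ν * (4 * Real.pi ^ 2 * design.modeEnstrophy ν mom n)
      = a n ^ 2 * (ν * (4 * Real.pi ^ 2 * freqNormSq (K n)) / ‖shearSymbol ν mom (K n)‖ ^ 2) := by
        show ν * (4 * Real.pi ^ 2 * (freqNormSq (K n) * (a n ^ 2 / ‖shearSymbol ν mom (K n)‖ ^ 2))) = _
        ring
    _ ≤ a n ^ 2 * (1 / (4 * Real.pi * d n)) := mul_le_mul_of_nonneg_left key (sq_nonneg _)
    _ = Real.pi * d n * (1 / 4 : ℝ) ^ n := by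
        have hd' : d n ≠ 0 := hd.ne'
        rw [ha]; field_simp

/-- The modewise ceiling against the uniform majorant `10π · 4⁻ⁿ`. -/
theorem mode_dissipation_le_bound (ν : ℝ) (n : ℕ) :
    ν * (4 * Real.pi ^ 2 * design.modeEnstrophy ν mom n) ≤ 10 * Real.pi * (1 / 4 : ℝ) ^ n := by
  refine (mode_dissipation_le ν n).trans ?_
  have h4 : (0 : ℝ) ≤ (1 / 4 : ℝ) ^ n := by positivity
  have hπd : Real.pi * d n ≤ 10 * Real.pi := by nlinarith [Real.pi_pos, d_le_ten n]
  exact mul_le_mul_of_nonneg_right hπd h4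

/-- The uniform majorant `π dₙ 4⁻ⁿ ≤ 10π · 4⁻ⁿ` is summable. -/
theorem summable_bound : Summable fun n : ℕ => 10 * Real.pi * (1 / 4 : ℝ) ^ n :=
  (summable_geometric_of_lt_one (by norm_num) (by norm_num)).mul_left _

/-- The modewise enstrophies of the Liouville design are summable at every `ν > 0`. -/
theorem modeEnstrophy_le {ν : ℝ} (hν : 0 < ν) (n : ℕ) :
    design.modeEnstrophy ν mom n ≤
      1 / (ν * (4 * Real.pi ^ 2)) * (10 * Real.pi * (1 / 4 : ℝ) ^ n) := by
  have hpos : 0 < ν * (4 * Real.pi ^ 2) := by positivity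
  rw [one_div_mul_eq_div, le_div_iff₀ hpos]
  calc design.modeEnstrophy ν mom n * (ν * (4 * Real.pi ^ 2))
      = ν * (4 * Real.pi ^ 2 * design.modeEnstrophy ν mom n) := by ring
    _ ≤ _ := mode_dissipation_le_bound ν n

/-- The modewise enstrophies of the Liouville design are summable at every `ν > 0`. -/
theorem summable_modeEnstrophy {ν : ℝ} (hν : 0 < ν) : Summable (design.modeEnstrophy ν mom) :=
  Summable.of_nonneg_of_le (design.modeEnstrophy_nonneg ν mom) (modeEnstrophy_le hν)
    (summable_bound.mul_left _)

/-- For a FIXED mode the dissipation density vanishes with the viscosity: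
`ν · 4π²|Kₙ|² aₙ²/|σ_ν(Kₙ)|² ≤ ν · 4π²|Kₙ|² aₙ²/(2π dₙ)² → 0`. [folklore] -/
theorem tendsto_mode_dissipation (ν : ℕ → ℝ) (hν : ∀ j, 0 < ν j) (hν0 : Tendsto ν atTop (𝓝 0))
    (n : ℕ) :
    Tendsto (fun j => ν j * (4 * Real.pi ^ 2 * design.modeEnstrophy (ν j) mom n)) atTop (𝓝 0) := by
  have hd := d_pos n
  have hle : ∀ j, ν j * (4 * Real.pi ^ 2 * design.modeEnstrophy (ν j) mom n) ≤
      ν j * (4 * Real.pi ^ 2 * (freqNormSq (K n) * (a n ^ 2 / (2 * Real.pi * d n) ^ 2))) := by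
    intro j
    refine mul_le_mul_of_nonneg_left ?_ (hν j).le
    refine mul_le_mul_of_nonneg_left ?_ (by positivity)
    show freqNormSq (K n) * (a n ^ 2 / ‖shearSymbol (ν j) mom (K n)‖ ^ 2) ≤ _
    refine mul_le_mul_of_nonneg_left ?_ (freqNormSq_nonneg _)
    refine div_le_div_of_nonneg_left (sq_nonneg _) (by positivity) ?_
    have := sq_kdot_le_norm_sq_shearSymbol (ν j) mom (K n)
    rwa [kdot_K_mom] at this
  have h0 : ∀ j, 0 ≤ ν j * (4 * Real.pi ^ 2 * design.modeEnstrophy (ν j) mom n) := fun j =>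
    mul_nonneg (hν j).le (mul_nonneg (by positivity) (design.modeEnstrophy_nonneg _ _ _))
  have hlim : Tendsto (fun j => ν j *
      (4 * Real.pi ^ 2 * (freqNormSq (K n) * (a n ^ 2 / (2 * Real.pi * d n) ^ 2)))) atTop (𝓝 0) := by
    simpa using hν0.mul_const (4 * Real.pi ^ 2 * (freqNormSq (K n) * (a n ^ 2 / (2 * Real.pi * d n) ^ 2)))
  exact squeeze_zero h0 hle hlim

/-- **Dissipation of the small-divisor family vanishes.** Along any positive `νⱼ → 0` the
laminar states of the Liouville design have `meanDissipation → 0` (Tannery's theorem with the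
majorant `10π 4⁻ⁿ`). [folklore] -/
theorem tendsto_meanDissipation (ν : ℕ → ℝ) (hν : ∀ j, 0 < ν j) (hν0 : Tendsto ν atTop (𝓝 0))
    {u : ℕ → 𝕋³ → E³}
    (hD : ∀ j, meanDissipation (ν j) (fun _ : ℝ => u j) = ν j * (eGradNormSq (u j)).toReal)
    (hco : ∀ j, mFourierCoeff (complexify ∘ u j) =
      design.stateCoeff (ν j) mom + (Pi.single (0 : Fin 3 → ℤ) (complexify mom) : (Fin 3 → ℤ) → ℂ³)) :
    Tendsto (fun j => meanDissipation (ν j) (fun _ : ℝ => u j)) atTop (𝓝 0) := by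
  -- the modewise dissipation densities and their sum
  obtain ⟨g, hg⟩ : ∃ g : ℕ → ℕ → ℝ, g = fun j n =>
    ν j * (4 * Real.pi ^ 2 * design.modeEnstrophy (ν j) mom n) := ⟨_, rfl⟩
  have hT : Tendsto (fun j => ∑' n, g j n) atTop (𝓝 (∑' _ : ℕ, (0 : ℝ))) := by
    refine tendsto_tsum_of_dominated_convergence summable_bound (fun n => ?_)
      (Eventually.of_forall fun j n => ?_)
    · rw [hg]; exact tendsto_mode_dissipation ν hν hν0 n
    · rw [hg]; dsimp only
      rw [Real.norm_of_nonneg (mul_nonneg (hν j).le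
        (mul_nonneg (by positivity) (design.modeEnstrophy_nonneg _ _ _)))]
      exact mode_dissipation_le_bound (ν j) n
  rw [tsum_zero] at hT
  have hup : ∀ j, meanDissipation (ν j) (fun _ : ℝ => u j) ≤ 2 * ∑' n, g j n := by
    intro j
    rw [hD j, hg]; dsimp only
    rw [tsum_mul_left, tsum_mul_left]
    have h := design.dissipation_le_of_coeff (hco j) (summable_modeEnstrophy (hν j))
    have := mul_le_mul_of_nonneg_left h (hν j).le
    linarith
  have hlow : ∀ j, 0 ≤ meanDissipation (ν j) (fun _ : ℝ => u j) := fun j => by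
    rw [hD j]; exact mul_nonneg (hν j).le ENNReal.toReal_nonneg
  refine squeeze_zero hlow hup ?_
  simpa using hT.const_mul 2

/-- **The first rung below the zeroth law, complete statement.** There is a FIXED smooth,
divergence-free, mean-zero force on `T³` such that along EVERY vanishing sequence of positive
viscosities there are global Leray–Hopf solutions with uniformly bounded mean energy, mean
enstrophy `meanDissipation/ν → ∞`, and mean energy dissipation rate `meanDissipation → 0`:
unbounded velocity gradients at bounded energy with NO anomalous dissipation.  Compare
`Literature.Turb.ZerothLaw` (dissipation `≥ ε > 0`) and
`SmallDivisor.exists_force_boundedEnergy_unboundedEnstrophy`. [folklore] -/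
theorem exists_force_rungOne :
    ∃ f : 𝕋³ → E³, Torus.IsSmooth f ∧ Torus.IsDivFree f ∧ Torus.HasZeroMean f ∧
      ∀ ν : ℕ → ℝ, (∀ j, 0 < ν j) → Tendsto ν atTop (𝓝 0) →
        ∃ (u₀ : ℕ → 𝕋³ → E³) (u : ℕ → ℝ → 𝕋³ → E³),
          (∀ j, Torus.IsGlobalLerayHopf (ν j) (fun _ => f) (u₀ j) (u j)) ∧
          (∃ E : ℝ, ∀ j, meanEnergy (u j) ≤ E) ∧
          Tendsto (fun j => meanDissipation (ν j) (u j) / ν j) atTop atTop ∧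
          Tendsto (fun j => meanDissipation (ν j) (u j)) atTop (𝓝 0) := by
  refine ⟨design.force, design.isSmooth_force, design.isDivFree_force, design.hasZeroMean_force,
    fun ν hν hν0 => ?_⟩
  obtain ⟨u, hLH, -, hE, hD, hZ, hco, -⟩ := exists_family ν hν hν0
  exact ⟨u, fun j _ => u j, hLH, ⟨_, hE⟩, hZ, tendsto_meanDissipation ν hν hν0 hD hco⟩

end SmallDivisor

end Summit.AnomalousDissipation.AnomalousDissipation.Theorems

end
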